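import Mathlib
import Literature.AlgebraicGeometry.Resolution.CompletedChainDescentTools
import Literature.AlgebraicGeometry.Resolution.AdaptedCoordinateChartStep
import HarnessLib

/-!
# An adapted presentation of a permissible curve centre (front end of the descent's curve step)

OURS (res-inputs-p-8b g2; sub-brick of res-inputs-p-7b g3's `stub_descent_curveStep`, OPTION R). In a regular local ring `S` of
dimension `3` with `τ = 1` in every regular system of parameters and `J` of order exactly `μ ≥ 1`:
* `hasMonic_of_forall_initialForms` — a label adapted to the directrix (`cl_μ(J) ⊆ k·Y^μ`) has a monic element;
* `exists_adapted_presentation_of_centre` — if `(l, p_f, p_o)` is an adapted regular system and the permissible centre `P ⊇ J`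
  (`J ⊆ P^μ`) is presented as `(y₁, p_f)`, then `P = (y″, p_f)` for an ADAPTED regular system `(y″, p_f, p_o)` — Cossart–Jannsen–Saito's
  Claim 13.8 / Cossart–Piltant p. 11 («we may choose `y` such that the curve is `V(y, u₁)`»), assembled from `exists_span_pair_eq_of_adapted`
  (res-inputs-p-7b) and `exists_adapted_coordinate_of_hasMonic`.
AI-written; AI review weaker than expert review. Nothing here is F-71 / T1 or a summit statement.
-/

noncomputable section

open IsLocalRing MvPolynomial

namespace Literature.AlgebraicGeometry.Resolution

universe u

variable {S : Type u} [CommRing S] [IsRegularLocalRing S]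

/-- **An adapted label has a monic element**: if `J ⊆ 𝔪^μ`, `J ⊄ 𝔪^{μ+1}` and every `μ`-initial form of `J` is `a·Y^μ`, then some
`g ∈ J` has `in_μ(g)` with a non-zero `Y^μ`-coefficient. [cite: CossartPiltant2008, §4 (10)] [cite: CossartJannsenSaito2020, (12.1)] -/
theorem hasMonic_of_forall_initialForms (c : Fin 3 → S) (hgen : Ideal.span {c 0, c 1, c 2} = maximalIdeal S)
    (hdim : ringKrullDim S = 3) {J : Ideal S} {μ : ℕ} (hJμ : J ≤ maximalIdeal S ^ μ) (hJne : ¬ J ≤ maximalIdeal S ^ (μ + 1))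
    (had : ∀ G ∈ initialForms c J μ, ∃ a : ResidueField S, G = C a * X 0 ^ μ) : HasMonic c J μ := by
  classical
  have hgenr := span_range_eq_of_span_triple c hgen
  obtain ⟨g, hgJ, hg⟩ := SetLike.not_le_iff_exists.mp hJne
  refine ⟨g, hgJ, ?_⟩
  have hmem : inForm c (fun _ => 1) μ g ∈ initialForms c J μ :=
    (mem_initialForms_iff_exists_inForm c hgen hdim hJμ _).mpr ⟨g, hgJ, rfl⟩
  obtain ⟨a, ha⟩ := had _ hmem
  have hne : inForm c (fun _ => 1) μ g ≠ 0 := by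
    intro h0
    have hg1 : g ∈ weightedIdealW c (fun _ => 1) μ := by
      rw [weightedIdealW_one_eq_pow c hgenr]; exact hJμ hgJ
    have h1 := (inForm_eq_zero_iff c hgen hdim (fun _ => Nat.one_pos) hg1).mp h0
    rw [weightedIdealW_one_eq_pow c hgenr] at h1
    exact hg h1
  have ha0 : a ≠ 0 := by
    rintro rfl
    rw [ha, map_zero, zero_mul] at hne
    exact hne rfl
  rw [ha, MvPolynomial.coeff_C_mul, MvPolynomial.coeff_X_pow, if_pos rfl, mul_one]
  exact ha0

/-- **An adapted presentation of a permissible curve centre.** `S` regular local of dimension `3`, `τ = 1` in every regular system,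
`J ⊆ 𝔪^μ`, `J ⊄ 𝔪^{μ+1}`, `μ ≥ 1`; `(l, p_f, p_o)` a regular system adapted to the directrix; `P` an ideal with `J ⊆ P^μ` presented as
`P = (y₁, p_f)` with `y₁ ∈ 𝔪`. Then `P = (y″, p_f)` for some `y″` with `(y″, p_f, p_o) = 𝔪` adapted to the directrix.
[cite: CossartJannsenSaito2020, Claim 13.8] [cite: CossartPiltant2008, Prop. 4.4 (proof, p. 11)] -/
theorem exists_adapted_presentation_of_centre (hdim : ringKrullDim S = 3) {J : Ideal S} {μ : ℕ} (hμ : 1 ≤ μ)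
    (hJμ : J ≤ maximalIdeal S ^ μ) (hJne : ¬ J ≤ maximalIdeal S ^ (μ + 1))
    (hτ : ∀ c : Fin 3 → S, Ideal.span {c 0, c 1, c 2} = maximalIdeal S → hironakaTauAt c J μ = 1)
    (l pf po : S) (hgen : Ideal.span {l, pf, po} = maximalIdeal S)
    (had : ∀ G ∈ initialForms ![l, pf, po] J μ, ∃ a : ResidueField S, G = C a * X 0 ^ μ)
    {P : Ideal S} (hJP : J ≤ P ^ μ) (hpres : ∃ y₁ ∈ maximalIdeal S, Ideal.span {y₁, pf} = P) :
    ∃ y'' : S, Ideal.span {y'', pf, po} = maximalIdeal S ∧ Ideal.span {y'', pf} = P ∧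
      ∀ G ∈ initialForms ![y'', pf, po] J μ, ∃ a : ResidueField S, G = C a * X 0 ^ μ := by
  classical
  obtain ⟨y₁, hy₁, hP⟩ := hpres
  have hgenc : Ideal.span {(![l, pf, po] : Fin 3 → S) 0, (![l, pf, po] : Fin 3 → S) 1, (![l, pf, po] : Fin 3 → S) 2} =
      maximalIdeal S := hgen
  have hJP1 : J ≤ Ideal.span {y₁, (![l, pf, po] : Fin 3 → S) 1} ^ μ := by
    change J ≤ Ideal.span {y₁, pf} ^ μ
    rw [hP]; exact hJP
  obtain ⟨r, hr⟩ := exists_span_pair_eq_of_adapted (![l, pf, po]) hgenc hdim hμ hJμ hJne had y₁ hy₁ hJP1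
  simp only [Matrix.cons_val_zero, Matrix.cons_val_one, Matrix.head_cons, Matrix.cons_val_two, Matrix.tail_cons] at hr
  have hmon : HasMonic ![l, pf, po] J μ := hasMonic_of_forall_initialForms _ hgenc hdim hJμ hJne had
  obtain ⟨y'', hgen'', hP'', had''⟩ :=
    exists_adapted_coordinate_of_hasMonic hdim l pf po hgen hJμ (by omega) hτ hmon True P
      (fun _ => ⟨0, r, by rw [zero_mul, zero_add, ← hr]; exact hP⟩) (fun _ => hJP)
  exact ⟨y'', hgen'', hP'' trivial, had''⟩

end Literature.AlgebraicGeometry.Resolution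

end
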